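/-
Copyright: the b2b-balaban T⁴-continuum CRUX team, row NE7b leaf lineage `t4-ne7b-formalise-leaf-03` (gen 152). Project licence.
-/
import Summits.QuantumFields.BalabanUV.T4Continuum.Spine.NE7b.OneShotChartFejer

/-!
# THE COMPLEX-COEFFICIENT FIBRE IDENTITY AND THE CONCENTRATION ESTIMATE FOR THE ONE-SHOT CHART
# (row NE7b, node U5c; tools for the `≥` direction of the η-ℓ² chart constant; [folklore] — nothing of Bałaban's)

Cell `pub-balaban`, sub-cell `t4`, spine estimate NE7b (`T4WeightBudget.RelWeightBound`; the cell's OWN estimate — NOT PRINTED in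
[Bałaban 1983–89], NOT PROVED).  Crux-route work under `Spine/NE7b/` by leaf-03 (CRUX team (2), FREEZE (0) crux-prover clause, gen 152),
FILING-CLAIM C-leaf03-g152-SHARP (journal [NE7bLEAF03-G152-ONLINE]).  NOTHING of Bałaban's is asserted; no `T4Continuum/Support` leaf; no
`def`; zero `sorry`.  Used BY NAME: the OWNER's (41) `OneShotChartFourier.kerH_chart_eq_latticeKernel` ∕ `continuousOn_G_div`, (42)
`OneShotChartBound.tsum_HB_sq_le_sharp` (summability of `(HB)²`), this lineage's OSFI `OneShotChartFibreIdentity.hasSum_normSq_latticeKernel`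
(Parseval for lattice kernels) and `OneShotChartFejer` (plane-wave packets: continuity, near mass).

WHAT IS PROVED ([folklore]; `n : ℕ` the mesh, `a > 0`):
* §1 **`tsum_normSq_Hc_eq_integral`** — the fibre identity for COMPLEX coefficients `c : T → ℂ` on a finite window:
  `Σ′_z ‖Σ_{y∈T} c_y H(z,y)‖² = (2π)^{−d}∫_{[−π,π]^d} (Σ_τ ‖G_τ(p)∕symbQGQ(p)‖²)·‖Σ_{y∈T} c_y e^{−ip·y}‖² dp` (block rows are Fourier
  coefficients of `(G_τ∕symbQGQ)·ĉ_T`, `Hc_chart_eq_latticeKernel`; Parseval per row, `hasSum_normSq_Hc_row`; blocks re-assembled).  The real case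
  is OSFI's `tsum_HB_sq_eq_integral`; complex coefficients are what lets ONE plane-wave packet concentrate at ONE momentum `p₀` (a real
  packet sees `±p₀`).
* §2 `continuousOn_mult` (the fibre multiplier `Σ_τ‖G_τ∕symbQGQ‖²` is continuous on the zone) and **`tsum_normSq_Hc_packet_ge`** — THE
  CONCENTRATION ESTIMATE: for an interior centre `p₀` (`|p₀_μ| ≤ π − ρ`), `0 < δ ≤ ρ`, `ε ≤ M(p₀)` and `M ≥ M(p₀) − ε` on the `δ`-cube around
  `p₀`, the packet `c_y = e^{ip₀·y}` on the box `[0,m+1)^d` has `Σ′_z‖Σ_y c_yH(z,y)‖² ≥ (M(p₀) − ε)·((m+1)^d − (π²∕δ²)·d·(m+1)^{d−1})`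
  (the identity of §1, the multiplier bounded below on the near cube, `OneShotChartFejer.packet_near_mass_ge`).
* §3 back to REAL fields: `Hc_packet_eq` ∕ `normSq_Hc_packet_eq` (`Σ_y e^{ip₀·y}H(z,y) = (H cos(p₀·))(z) + i(H sin(p₀·))(z)`, so
  `‖·‖² = (H cos)² + (H sin)²`), `sum_cos_sq_add_sin_sq` (`Σ_T cos² + Σ_T sin² = #T`), `tsum_HB_sq_eq_zero_of_sum_sq_eq_zero`, and the
  **`mediant`** step (`K(b₁+b₂) ≤ a₁+a₂`, `b₁+b₂ > 0` ⟹ some `i` has `bᵢ > 0`, `K bᵢ ≤ aᵢ`): one of the two real fields inherits the ratio.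

NOT HERE (honest): the END statements (`OneShotChartFibreSharp`); anything of Bałaban's.  BY-NAME EFFECT ON THE WALL: NONE.  NE7b NOT PRINTED ∕
NOT PROVED; spine PROVED 0∕9; rung (B)+1 on a FINITE torus — NOT infinite volume, NOT the mass gap, NOT Clay.  HONEST DEPENDENCY: continuum YM
on T⁴ ⇐ BetaPertH ∧ nine spine estimates (0∕9 proved); BetaPertH ⇐ (D1) ∧ (D4) ∧ CAP+tail; G-an2-4 gates asym, D1 and NE2∕3∕4.
-/

set_option autoImplicit false

namespace Summit.QuantumFields.BalabanUV.T4Continuum.NE7b.OneShotChartConcentration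

open Finset Complex MeasureTheory Filter Topology Set
open Literature.MathematicalPhysics.QuantumFieldTheory.Balaban1983to89
open B4Strip (ofRealVec)
open B4StripSums (G)
open B4ContourShift (BZ latticeKernel integrand)
open B4Green244 (phaseC phaseC_ofRealVec latticeKernel_sum_mul latticeKernel_phase_mul)
open B6QGQLower276 (X B chart)
open B6QGQDecay237 (card_B)
open B5Hk103ScalarZd (kerH tsum_blocks blockEquiv)
open B5Hk103Minimizer (HB)
open B5Momentum166Zd (FTsq isCompact_BZ measurableSet_BZ phaseC_eq)
open B5Ineq167SymbolZd (phase)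
open B6QGQFourier275Zd (symbQGQ continuous_cexp_phase sum_B_eq)
open OneShotChartFourier (kerH_chart_eq_latticeKernel continuousOn_G_div integrableOn_integrand_of_continuousOn)
open OneShotChartBound (tsum_HB_sq_le_sharp)
open OneShotChartFibreIdentity (hasSum_normSq_latticeKernel)
open OneShotChartFejer (continuous_trigPoly packet_mass packet_near_mass_ge norm_wave)
open scoped Real

noncomputable section

variable {d : ℕ}

/-! ## §1. The fibre identity for COMPLEX coefficients: `Σ′_z ‖Σ_{y∈T} c_yH(z,y)‖² = (2π)^{−d}∫ (Σ_τ‖G_τ∕symbQGQ‖²)·‖ĉ‖²` -/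

/-- block rows of `H c` for complex coefficients are Fourier coefficients of `(G_τ∕symbQGQ)·ĉ_T` ((42) §1 verbatim with `c_y ∈ ℂ`). [folklore] -/
theorem Hc_chart_eq_latticeKernel (n : ℕ) {a : ℝ} (ha : 0 < a) (T : Finset (X d)) (c : X d → ℂ) (x : X d)
    (τ : Fin d → Fin (n + 1)) :
    ∑ y ∈ T, c y * (kerH n a (chart n x τ) y : ℂ)
      = latticeKernel (fun P => G (n + 1) a 0 τ P / symbQGQ (n + 1) a P
          * ∑ y ∈ T, c y * cexp (I * phaseC P (-y))) x := by
  have hint : ∀ y ∈ T, IntegrableOn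
      (integrand (fun P => cexp (I * phaseC P (-y)) * (G (n + 1) a 0 τ P / symbQGQ (n + 1) a P)) x) (BZ d) := by
    intro y _
    refine integrableOn_integrand_of_continuousOn ?_ x
    have hc : Continuous fun p : Fin d → ℝ => cexp (I * phaseC (ofRealVec p) (-y)) := by
      simp_rw [phaseC_ofRealVec]; exact continuous_cexp_phase (-y)
    exact hc.continuousOn.mul (continuousOn_G_div n ha τ)
  have h1 : (fun P => G (n + 1) a 0 τ P / symbQGQ (n + 1) a P * ∑ y ∈ T, c y * cexp (I * phaseC P (-y)))
      = fun P => ∑ y ∈ T, c y * (cexp (I * phaseC P (-y)) * (G (n + 1) a 0 τ P / symbQGQ (n + 1) a P)) := by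
    funext P
    rw [Finset.mul_sum]
    exact Finset.sum_congr rfl fun y _ => by ring
  rw [h1, latticeKernel_sum_mul T c _ x hint]
  refine Finset.sum_congr rfl fun y _ => ?_
  rw [kerH_chart_eq_latticeKernel n ha x y τ, latticeKernel_phase_mul, ← sub_eq_add_neg]

/-- the complex row integrand is continuous on the zone. [folklore] -/
theorem continuousOn_rowMult_c (n : ℕ) {a : ℝ} (ha : 0 < a) (τ : Fin d → Fin (n + 1)) (T : Finset (X d)) (c : X d → ℂ) :
    ContinuousOn (fun p : Fin d → ℝ => G (n + 1) a 0 τ (ofRealVec p) / symbQGQ (n + 1) a (ofRealVec p)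
      * ∑ y ∈ T, c y * cexp (I * phaseC (ofRealVec p) (-y))) (BZ d) :=
  (continuousOn_G_div n ha τ).mul (continuous_trigPoly T c).continuousOn

/-- **each block row, exactly** (Parseval): `Σ′_x ‖Σ_y c_yH(chart n x τ, y)‖² = (2π)^{−d}∫‖(G_τ∕symbQGQ)ĉ_T‖²`, as a `HasSum`. [folklore] -/
theorem hasSum_normSq_Hc_row (n : ℕ) {a : ℝ} (ha : 0 < a) (T : Finset (X d)) (c : X d → ℂ) (τ : Fin d → Fin (n + 1)) :
    HasSum (fun x : X d => ‖∑ y ∈ T, c y * (kerH n a (chart n x τ) y : ℂ)‖ ^ 2)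
      (((2 * π) ^ d)⁻¹ * ∫ p in BZ d, ‖G (n + 1) a 0 τ (ofRealVec p) / symbQGQ (n + 1) a (ofRealVec p)
        * ∑ y ∈ T, c y * cexp (I * phaseC (ofRealVec p) (-y))‖ ^ 2) := by
  have h := hasSum_normSq_latticeKernel (fun P => G (n + 1) a 0 τ P / symbQGQ (n + 1) a P
    * ∑ y ∈ T, c y * cexp (I * phaseC P (-y))) (continuousOn_rowMult_c n ha τ T c)
  have h1 : ∀ x : X d, ‖latticeKernel (fun P => G (n + 1) a 0 τ P / symbQGQ (n + 1) a P
      * ∑ y ∈ T, c y * cexp (I * phaseC P (-y))) x‖ ^ 2 = ‖∑ y ∈ T, c y * (kerH n a (chart n x τ) y : ℂ)‖ ^ 2 :=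
    fun x => by rw [Hc_chart_eq_latticeKernel n ha T c x τ]
  simp_rw [h1] at h
  exact h

/-- **THE FIBRE IDENTITY FOR COMPLEX COEFFICIENTS**: for every finite window `T` and `c : T → ℂ`,
`Σ′_z ‖Σ_{y∈T} c_y H(z,y)‖² = (2π)^{−d}∫_{[−π,π]^d} (Σ_τ ‖G_τ(p)∕symbQGQ(p)‖²)·‖Σ_{y∈T} c_y e^{−ip·y}‖² dp` (and the left side is summable). [folklore] -/
theorem tsum_normSq_Hc_eq_integral (n : ℕ) {a : ℝ} (ha : 0 < a) (T : Finset (X d)) (c : X d → ℂ) :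
    (Summable fun z : X d => ‖∑ y ∈ T, c y * (kerH n a z y : ℂ)‖ ^ 2) ∧
    ∑' z : X d, ‖∑ y ∈ T, c y * (kerH n a z y : ℂ)‖ ^ 2 = ((2 * π) ^ d)⁻¹ *
      ∫ p in BZ d, (∑ τ : Fin d → Fin (n + 1), ‖G (n + 1) a 0 τ (ofRealVec p) / symbQGQ (n + 1) a (ofRealVec p)‖ ^ 2)
        * ‖∑ y ∈ T, c y * cexp (I * phaseC (ofRealVec p) (-y))‖ ^ 2 := by
  have hrow := fun τ => hasSum_normSq_Hc_row n ha T c τ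
  -- summability over the fine lattice, block row by block row
  have hS : Summable fun z : X d => ‖∑ y ∈ T, c y * (kerH n a z y : ℂ)‖ ^ 2 := by
    rw [← (blockEquiv (d := d) n).summable_iff]
    have h3 : (fun z : X d => ‖∑ y ∈ T, c y * (kerH n a z y : ℂ)‖ ^ 2) ∘ (blockEquiv (d := d) n)
        = fun yτ : X d × (Fin d → Fin (n + 1)) => ‖∑ y ∈ T, c y * (kerH n a (chart n yτ.1 yτ.2) y : ℂ)‖ ^ 2 := by
      funext yτ; rfl
    rw [h3]
    refine (summable_prod_of_nonneg (fun yτ => by positivity)).mpr ⟨fun y => (hasSum_fintype _).summable, ?_⟩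
    simp_rw [tsum_fintype]
    exact summable_sum fun τ _ => (hrow τ).summable
  refine ⟨hS, ?_⟩
  set g : (Fin d → Fin (n + 1)) → (Fin d → ℝ) → ℝ := fun τ p =>
    ‖G (n + 1) a 0 τ (ofRealVec p) / symbQGQ (n + 1) a (ofRealVec p)
      * ∑ y ∈ T, c y * cexp (I * phaseC (ofRealVec p) (-y))‖ ^ 2 with hg
  have hgi : ∀ τ, IntegrableOn (g τ) (BZ d) := fun τ =>
    ((continuousOn_rowMult_c n ha τ T c).norm.pow 2).integrableOn_compact isCompact_BZ
  calc ∑' z : X d, ‖∑ y ∈ T, c y * (kerH n a z y : ℂ)‖ ^ 2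
      = ∑' x : X d, ∑ q ∈ B n x, ‖∑ y ∈ T, c y * (kerH n a q y : ℂ)‖ ^ 2 := (tsum_blocks n hS).symm
    _ = ∑' x : X d, ∑ τ : Fin d → Fin (n + 1), ‖∑ y ∈ T, c y * (kerH n a (chart n x τ) y : ℂ)‖ ^ 2 :=
        tsum_congr fun x => sum_B_eq n x _
    _ = ∑ τ : Fin d → Fin (n + 1), ∑' x : X d, ‖∑ y ∈ T, c y * (kerH n a (chart n x τ) y : ℂ)‖ ^ 2 :=
        Summable.tsum_finsetSum fun τ _ => (hrow τ).summable
    _ = ∑ τ : Fin d → Fin (n + 1), ((2 * π) ^ d)⁻¹ * ∫ p in BZ d, g τ p :=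
        Finset.sum_congr rfl fun τ _ => (hrow τ).tsum_eq
    _ = ((2 * π) ^ d)⁻¹ * ∫ p in BZ d, ∑ τ : Fin d → Fin (n + 1), g τ p := by
        rw [← Finset.mul_sum, integral_finsetSum _ fun τ _ => hgi τ]
    _ = ((2 * π) ^ d)⁻¹ * ∫ p in BZ d,
          (∑ τ : Fin d → Fin (n + 1), ‖G (n + 1) a 0 τ (ofRealVec p) / symbQGQ (n + 1) a (ofRealVec p)‖ ^ 2)
            * ‖∑ y ∈ T, c y * cexp (I * phaseC (ofRealVec p) (-y))‖ ^ 2 := by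
        congr 1
        refine setIntegral_congr_fun measurableSet_BZ fun p _ => ?_
        simp only [hg, Finset.sum_mul]
        exact Finset.sum_congr rfl fun τ _ => by rw [norm_mul, mul_pow]

/-! ## §2. The fibre multiplier `Σ_τ‖G_τ∕symbQGQ‖²` is continuous on the zone; the packet concentrates it at `p₀` -/

/-- the fibre multiplier is continuous on `[−π,π]^d`. [folklore] -/
theorem continuousOn_mult (n : ℕ) {a : ℝ} (ha : 0 < a) :
    ContinuousOn (fun p : Fin d → ℝ =>
      ∑ τ : Fin d → Fin (n + 1), ‖G (n + 1) a 0 τ (ofRealVec p) / symbQGQ (n + 1) a (ofRealVec p)‖ ^ 2) (BZ d) :=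
  continuousOn_finsetSum _ fun τ _ => (continuousOn_G_div n ha τ).norm.pow 2

/-- **THE CONCENTRATION ESTIMATE**: for an interior centre `p₀` (`|p₀_μ| ≤ π − ρ`), `0 < δ ≤ ρ`, `0 ≤ ε ≤ M(p₀)` with
`M ≥ M(p₀) − ε` on the `δ`-cube around `p₀` (within the zone), the plane-wave packet `c_y = e^{ip₀·y}` on the box `[0,m+1)^d` has
`Σ′_z ‖Σ_y c_yH(z,y)‖² ≥ (M(p₀) − ε)·((m+1)^d − (π²∕δ²)·d·(m+1)^{d−1})`. [folklore] -/
theorem tsum_normSq_Hc_packet_ge (n : ℕ) {a : ℝ} (ha : 0 < a) (p₀ : Fin d → ℝ) {ρ δ ε : ℝ}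
    (hδ : 0 < δ) (hδρ : δ ≤ ρ) (hp₀ : ∀ μ, |p₀ μ| ≤ π - ρ)
    (hεM : ε ≤ ∑ τ : Fin d → Fin (n + 1), ‖G (n + 1) a 0 τ (ofRealVec p₀) / symbQGQ (n + 1) a (ofRealVec p₀)‖ ^ 2)
    (hnear : ∀ p ∈ BZ d, (∀ μ, |p μ - p₀ μ| < δ) →
      (∑ τ : Fin d → Fin (n + 1), ‖G (n + 1) a 0 τ (ofRealVec p₀) / symbQGQ (n + 1) a (ofRealVec p₀)‖ ^ 2) - ε
        ≤ ∑ τ : Fin d → Fin (n + 1), ‖G (n + 1) a 0 τ (ofRealVec p) / symbQGQ (n + 1) a (ofRealVec p)‖ ^ 2)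
    (m : ℕ) :
    ((∑ τ : Fin d → Fin (n + 1), ‖G (n + 1) a 0 τ (ofRealVec p₀) / symbQGQ (n + 1) a (ofRealVec p₀)‖ ^ 2) - ε)
        * (((m : ℝ) + 1) ^ d - π ^ 2 / δ ^ 2 * (d * ((m : ℝ) + 1) ^ (d - 1)))
      ≤ ∑' z : X d, ‖∑ y ∈ B m 0, cexp (I * ((phase p₀ y : ℝ) : ℂ)) * (kerH n a z y : ℂ)‖ ^ 2 := by
  set M : (Fin d → ℝ) → ℝ := fun p =>
    ∑ τ : Fin d → Fin (n + 1), ‖G (n + 1) a 0 τ (ofRealVec p) / symbQGQ (n + 1) a (ofRealVec p)‖ ^ 2 with hM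
  set Φ : (Fin d → ℝ) → ℝ := fun p =>
    ‖∑ y ∈ B m 0, cexp (I * ((phase p₀ y : ℝ) : ℂ)) * cexp (I * phaseC (ofRealVec p) (-y))‖ ^ 2 with hΦ
  have hMc : ContinuousOn M (BZ d) := continuousOn_mult n ha
  have hΦc : Continuous Φ := (continuous_trigPoly (B m 0) _).norm.pow 2
  have hMΦ : IntegrableOn (fun p => M p * Φ p) (BZ d) := (hMc.mul hΦc.continuousOn).integrableOn_compact isCompact_BZ
  have hid := (tsum_normSq_Hc_eq_integral n ha (B m 0) (fun y => cexp (I * ((phase p₀ y : ℝ) : ℂ)))).2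
  have hpi : (0 : ℝ) < (2 * π) ^ d := by positivity
  have hM0 : 0 ≤ M p₀ - ε := by simp only [hM]; linarith
  -- restrict to the near region, bound the multiplier below there
  have hnear' : ∀ p ∈ BZ d \ {p | ∃ μ, δ ≤ |p μ - p₀ μ|}, (M p₀ - ε) * Φ p ≤ M p * Φ p := by
    intro p hp
    have hall : ∀ μ, |p μ - p₀ μ| < δ := fun μ => by
      by_contra h
      exact hp.2 ⟨μ, not_lt.mp h⟩
    exact mul_le_mul_of_nonneg_right (hnear p hp.1 hall) (sq_nonneg _)
  have hsub : BZ d \ {p | ∃ μ, δ ≤ |p μ - p₀ μ|} ⊆ BZ d := fun p hp => hp.1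
  have hmeas : MeasurableSet (BZ d \ {p : Fin d → ℝ | ∃ μ, δ ≤ |p μ - p₀ μ|}) :=
    measurableSet_BZ.diff (OneShotChartFejer.measurableSet_far p₀ δ)
  have hnm := packet_near_mass_ge m p₀ hδ hδρ hp₀
  have hinv : (0 : ℝ) ≤ ((2 * π) ^ d)⁻¹ := inv_nonneg.mpr hpi.le
  have hstep1 : (M p₀ - ε) * (((m : ℝ) + 1) ^ d - π ^ 2 / δ ^ 2 * (d * ((m : ℝ) + 1) ^ (d - 1)))
      = ((2 * π) ^ d)⁻¹ * ((M p₀ - ε) *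
          ((2 * π) ^ d * ((m : ℝ) + 1) ^ d - π ^ 2 / (4 * δ ^ 2) * (d * (4 * (2 * π) ^ d * ((m : ℝ) + 1) ^ (d - 1))))) := by
    field_simp
  have hstep2 : ((2 * π) ^ d)⁻¹ * ((M p₀ - ε) *
          ((2 * π) ^ d * ((m : ℝ) + 1) ^ d - π ^ 2 / (4 * δ ^ 2) * (d * (4 * (2 * π) ^ d * ((m : ℝ) + 1) ^ (d - 1)))))
      ≤ ((2 * π) ^ d)⁻¹ * ((M p₀ - ε) * ∫ p in BZ d \ {p | ∃ μ, δ ≤ |p μ - p₀ μ|}, Φ p) :=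
    mul_le_mul_of_nonneg_left (mul_le_mul_of_nonneg_left hnm hM0) hinv
  have hstep3 : (M p₀ - ε) * ∫ p in BZ d \ {p | ∃ μ, δ ≤ |p μ - p₀ μ|}, Φ p
      = ∫ p in BZ d \ {p | ∃ μ, δ ≤ |p μ - p₀ μ|}, (M p₀ - ε) * Φ p := (integral_const_mul _ _).symm
  have hstep4 : ∫ p in BZ d \ {p | ∃ μ, δ ≤ |p μ - p₀ μ|}, (M p₀ - ε) * Φ p
      ≤ ∫ p in BZ d \ {p | ∃ μ, δ ≤ |p μ - p₀ μ|}, M p * Φ p :=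
    setIntegral_mono_on (((hΦc.continuousOn.integrableOn_compact isCompact_BZ).mono_set hsub).const_mul _)
      (hMΦ.mono_set hsub) hmeas hnear'
  have hstep5 : ∫ p in BZ d \ {p | ∃ μ, δ ≤ |p μ - p₀ μ|}, M p * Φ p ≤ ∫ p in BZ d, M p * Φ p :=
    setIntegral_mono_set hMΦ
      (Eventually.of_forall fun p => show (0 : ℝ) ≤ M p * Φ p from
        mul_nonneg (Finset.sum_nonneg fun τ _ => sq_nonneg _) (sq_nonneg _))
      (Eventually.of_forall hsub)
  rw [hstep1, hid]
  refine hstep2.trans ?_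
  rw [hstep3]
  exact mul_le_mul_of_nonneg_left (hstep4.trans hstep5) hinv

/-! ## §3. Back to REAL fields: the packet is `cos(p₀·y) + i·sin(p₀·y)`, and one of the two parts inherits the ratio -/

/-- `Σ_y e^{ip₀·y}H(z,y) = (H cos(p₀·))(z) + i·(H sin(p₀·))(z)`. [folklore] -/
theorem Hc_packet_eq (n : ℕ) (a : ℝ) (T : Finset (X d)) (p₀ : Fin d → ℝ) (z : X d) :
    ∑ y ∈ T, cexp (I * ((phase p₀ y : ℝ) : ℂ)) * (kerH n a z y : ℂ)
      = (HB n a T (fun y => Real.cos (phase p₀ y)) z : ℂ) + (HB n a T (fun y => Real.sin (phase p₀ y)) z : ℂ) * I := by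
  unfold HB
  push_cast
  rw [Finset.sum_mul, ← Finset.sum_add_distrib]
  refine Finset.sum_congr rfl fun y _ => ?_
  rw [mul_comm I, Complex.exp_mul_I]
  ring

/-- `‖Σ_y e^{ip₀·y}H(z,y)‖² = (H cos(p₀·))(z)² + (H sin(p₀·))(z)²`. [folklore] -/
theorem normSq_Hc_packet_eq (n : ℕ) (a : ℝ) (T : Finset (X d)) (p₀ : Fin d → ℝ) (z : X d) :
    ‖∑ y ∈ T, cexp (I * ((phase p₀ y : ℝ) : ℂ)) * (kerH n a z y : ℂ)‖ ^ 2
      = HB n a T (fun y => Real.cos (phase p₀ y)) z ^ 2 + HB n a T (fun y => Real.sin (phase p₀ y)) z ^ 2 := by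
  rw [Hc_packet_eq, Complex.norm_add_mul_I, Real.sq_sqrt (by positivity)]

/-- `Σ_{y∈T} (cos²(p₀·y) + sin²(p₀·y)) = #T`. [folklore] -/
theorem sum_cos_sq_add_sin_sq (T : Finset (X d)) (p₀ : Fin d → ℝ) :
    ∑ y ∈ T, Real.cos (phase p₀ y) ^ 2 + ∑ y ∈ T, Real.sin (phase p₀ y) ^ 2 = (T.card : ℝ) := by
  rw [← Finset.sum_add_distrib]
  simp_rw [Real.cos_sq_add_sin_sq]
  rw [Finset.sum_const, nsmul_eq_mul, mul_one]

/-- a field vanishing in square-sum on `T` has `H`-image zero. [folklore] -/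
theorem tsum_HB_sq_eq_zero_of_sum_sq_eq_zero (n : ℕ) (a : ℝ) (T : Finset (X d)) (Bf : X d → ℝ)
    (h : ∑ y ∈ T, Bf y ^ 2 = 0) : ∑' z : X d, HB n a T Bf z ^ 2 = 0 := by
  have hB : ∀ y ∈ T, Bf y = 0 := fun y hy => by
    have := (Finset.sum_eq_zero_iff_of_nonneg fun y _ => sq_nonneg (Bf y)).mp h y hy
    exact pow_eq_zero_iff (n := 2) (by norm_num) |>.mp this
  have hz : ∀ z : X d, HB n a T Bf z = 0 := fun z => Finset.sum_eq_zero fun y hy => by rw [hB y hy, zero_mul]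
  simp_rw [hz]
  simp

/-- **THE MEDIANT STEP**: if `K(b₁ + b₂) ≤ a₁ + a₂` with `b₁ + b₂ > 0`, `bᵢ ≥ 0`, and `bᵢ = 0 ⇒ aᵢ = 0`, then for some `i`,
`bᵢ > 0` and `K·bᵢ ≤ aᵢ`. [folklore] -/
theorem mediant {a₁ a₂ b₁ b₂ K : ℝ} (h : K * (b₁ + b₂) ≤ a₁ + a₂) (hb : 0 < b₁ + b₂) (hb₁ : 0 ≤ b₁) (hb₂ : 0 ≤ b₂)
    (hz₁ : b₁ = 0 → a₁ = 0) (hz₂ : b₂ = 0 → a₂ = 0) :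
    (0 < b₁ ∧ K * b₁ ≤ a₁) ∨ (0 < b₂ ∧ K * b₂ ≤ a₂) := by
  by_cases h1 : 0 < b₁
  · by_cases h1' : K * b₁ ≤ a₁
    · exact Or.inl ⟨h1, h1'⟩
    · right
      push Not at h1'
      by_cases h2 : 0 < b₂
      · exact ⟨h2, by linarith⟩
      · have hb2 : b₂ = 0 := le_antisymm (not_lt.mp h2) hb₂
        have := hz₂ hb2
        subst hb2
        exact absurd h (by linarith)
  · have hb1 : b₁ = 0 := le_antisymm (not_lt.mp h1) hb₁
    have ha1 := hz₁ hb1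
    subst hb1
    right
    exact ⟨by linarith, by linarith⟩


end

end Summit.QuantumFields.BalabanUV.T4Continuum.NE7b.OneShotChartConcentration
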